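import Literature.MathematicalPhysics.QuantumFieldTheory.Balaban1983to89.B3Ineq210ZeroBox

/-!
# `Balaban1983to89.B3Ineq212ZeroBox` — T. Bałaban, *(Higgs)₂,₃ quantum fields in a finite volume. III. Renormalization*,
# Commun. Math. Phys. **88** (1983) 411–445 [Balaban1983Higgs3]: the averaged vector-leg bound (2.12) p. 426,
# `|G^η_{(j)}(Γ^{(j+1)}_{x_{j+1},x}, b)| ≤ O(1)(L^jη)^{−d+3}e^{−δ₁(L^jη)^{−1}dist(B^j(x),b)}`, PROVED for the MODEL INSTANCE
# `A = B̃ = 0`, `Ω = □` a rectangular parallelepiped, every scale `k ≥ 1` — `ScaledKernels.Ineq212 δ₁ C` (and `Ineq210`)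
# DISCHARGED for the extended concrete carrier `zeroBoxKernelsV`

statement-level skeleton of published theorems with citation tags; proofs where landed; nothing here is a claim about the Yang–Mills mass gap

PDF held: `paper:balaban1983-higgs-2-3-quantum-fields-finite-volume` (journal page = PDF page + 410); p. 426 [PDF 16] (2.10)–(2.12) read
on the render `run/shared/lean/pub/pub-balaban/b2b-balaban-ref1/pages/1983-cmp88-higgs23-III/1983-cmp88-higgs23-III-p016-x2.png`;
paper I = T. Bałaban, *(Higgs)₂,₃ quantum fields in a finite volume. I. A lower bound*, Commun. Math. Phys. **85** (1982) 603–636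
[Balaban1982Higgs1], p. 608 [PDF 6] (2.1)–(2.3) (the contours `Γ_{y,x}`, `Γ^{(k)}_{y,x}`) read on the render
`…/1982-cmp85-higgs23-I/1982-cmp85-higgs23-I-p006-x2.png`.

CITATION HEADER (lean-in-tree rule).  Part of the lit-balaban TYPED SKELETON (HOME `run/shared/lean/pub/lit-balaban/`), Phase 2:
SKELETON row **B3.Eq2.12** (`HOME/lit-balaban-r15/ROWS-B3.md`, fold owner r15; decl of record `B3Sect2StatementsPart2.ScaledKernels.Ineq212`,
typed p239134 over the ABSTRACT carrier `ScaledKernels`); companion of `B3Ineq210ZeroBox` (row B3.Eq2.10, p253409).  WHAT IS PRINTED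
(B3 p. 426): *"Of course the same inequalities hold for vector field propagators, but we have to estimate some additional expressions
also. If a leg A′ of the line is in one of the vertices (1.14) and (1.15), then we have the expression A′^{(j),η}(Γ^{j+1}_{x_{j+1},x}) on
the basis of (1.3). For each such expression we have an additional factor L^jη on the right side, e.g. we have
|G^η_{(j)}(Γ^{(j+1)}_{x_{j+1},x}, b)| ≤ O(1)(L^jη)^{−d+3}e^{−δ₁(L^jη)^{−1}dist(B^j(x),b)}. (2.12)"*; (B3 p. 412, (1.3)): *"A(Γ^{(k)}_{y,x}) =
Σ_{j=0}^{k−1} A′^{(j),η}(Γ^{(j+1)}_{x_{j+1},x}) + A^{(k)}(Γ^{(k)}_{y,x}), where x_j is defined by the condition x ∈ B^j(x_j), x₀ = x, and the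
contours are defined in Chap. I.2. For an arbitrary vector field A defined on η-lattice and an arbitrary contour Γ of this lattice we
put A(Γ) = Σ_{b⊂Γ} ηA_b"*; (paper I p. 608, (2.1)–(2.2)): *"Γ_{y,x} = ⟨y, (y₁, …, y_{d−1}, x_d)⟩ ∪ ⟨(y₁, …, y_{d−1}, x_d), (y₁, …, y_{d−2},
x_{d−1}, x_d)⟩ … ∪ ⟨(y₁, x₂, …, x_d), x⟩, (2.1) … We consider Γ_{y,x} as an oriented contour, with y as an initial point and x as a
final point. … Each such contour is composed of the bonds of ε-lattice … Let us denote by x_j a point of torus T^{(j)}_{L^jε}, such that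
x ∈ B^j(x_j). Of course x_k = y and x_j ∈ B(x_{j+1}). We define Γ^{(k)}_{y,x} = Γ_{y,x_{k−1}} ∪ Γ_{x_{k−1},x_{k−2}} ∪ … ∪ Γ_{x_1,x}, (2.2)"*;
(paper I p. 608): *"The renormalization transformations for vector fields will be obtained by taking N = d and an external vector field
A = 0"*.

WHAT IS REPRODUCED, and how (kind «model-instance», G.1 of `HOME/PHASE2-TARGETS.md`; same instance as `B3Ineq210ZeroBox`).
* §1 the composite contours `Γ^{(n)}_{x_n,x}` of paper I (2.1)–(2.2) on the lattice `ℤ^{d+1}` (fine units): corners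
  `x_i = L^i⌊x/L^i⌋` (`cornerPt`), staircases `Γ_{x_{i+1},x_i}` as sets of positively oriented fine bonds (`seg`, `stair`), their union
  `contourN ℓ n x`; PROVED: the base points lie between `x_n` and `x` (`contourN_bounds`), hence in the box (`contourN_mem_boxDom`) and
  within `L^n` of `x` (`supNorm_sub_contourN_le`), and the count `#Γ^{(n)}_{x_n,x} ≤ Σ_c(x_c − (x_n)_c) ≤ (d+1)(L^n − 1)` (`card_contourN_le`;
  the staircases telescope).
* §2 the (2.12) objects at `A = 0`: the vector-field scale piece between bonds `δ_{νμ}·G_{(j)}(z, x_b)` (`vecPiece`; `N = d + 1`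
  independent copies of the scalar pieces `B3Ineq210ZeroBox.piece`), the contour sum `gsum j x b = Σ_{b′⊂Γ^{(j+1)}(x)} vecPiece b′ b`,
  the block `B^j(x) ∩ □` (`blockSites`) and `dist(B^j(x), b)` (`distBlockLat`, sup-distance to the two end-points of `b`).
* §3 **(2.12), counting normalisation** (`abs_gsum_le`): `|gsum j x b| ≤ C·L^{−jd}·(L^jη)²·e^{−δ₁|x−x_b|_∞/L^j}` — one factor `L^j` more than
  (2.10) (`B3Ineq210ZeroBox.abs_piece_le`), from the bond count and `|z − x_b| ≥ |x − x_b| − L^{j+1}` along the contour.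
* §4 the EXTENDED CARRIER `zeroBoxKernelsV` (= `B3Ineq210ZeroBox.zeroBoxKernels` with `Bond`, `absGavg`, `distBlock` modelled:
  `absGavg j x b = η^{−(d+1)}·|Σ_{b′⊂Γ} η·vecPiece b′ b|`, `distBlock j x b = η·distBlockLat`), **`ineq212_zeroBoxV`**: `∃ δ₁ > 0, C > 0`
  (on `d`, `L`, the window only) with `(zeroBoxKernelsV ℓ k hℓ M a m2).Ineq212 δ₁ C` for every `k ≥ 1`, window point and box; and
  `ineq210_zeroBoxV` (the (2.10) fields coincide with `zeroBoxKernels`, so `B3Ineq210ZeroBox.ineq210_zeroBox` applies verbatim).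
* §5 a non-vacuity witness (`d + 1 = 3`, `L = 2`, `k = 1`, unit cube).

HONEST SCOPE / DECLARED DIVERGENCES (F7).  (i) As `B3Ineq210ZeroBox`: only `A = B̃ = 0` (the vector field then IS `N = d + 1`
independent scalar copies, paper I p. 608; `U ≡ 1`, no parallel transport along `Γ`), `Ω = □` a box of unit blocks with Neumann
conditions, every `k ≥ 1`, running constants in a window; not general `Ω ⊂ T_η`, not the torus.  (ii) `Bond` = (base point `x_b ∈ □`,
direction `μ`); pairs with `x_b + e_μ ∉ □` are not bonds of the Neumann box — harmless extra elements for which the bound is proved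
too.  (iii) `dist(B^j(x), b)` = sup-distance (lattice units × `η`) from `B^j(x) ∩ □` to the two end-points of `b` (the print does not
fix the norm; Euclidean `≥` sup, so the printed form follows with `δ₁/√(d+1)`); only `dist(B^j(x),b) ≤ |x − x_b|_∞` is used.  (iv)
Constants existential, depending on `d`, `L`, the window (print: O(1)).  (v) The (2.5)/(2.11) fields of the carrier (`LocFn`, `dist2`,
`distSupp`, `distΩ₂`, `eRun`, `pRun`, `holderDiff`, `normDeltaG`, `norm116`) remain NOT MODELLED (`Unit`/`0`); nothing is claimed about
`Ineq25`/`Ineq211` of this instance.  (vi) ROUTE = the print's («an additional factor L^jη»: the contour has `≤ (d+1)L^{j+1}` bonds of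
weight `η`, each carrying the pointwise bound (2.10)), over the kernel-proved `A = 0` box lineage (`B3Ineq210ZeroBox` ← `B4Thm110ZeroBox`,
`B4Thm110ZeroBoxDeriv`, `B4BoxCov237`); no Literature fact is minted, every input is a kernel theorem.  Value = kernel certificate of a
located by-reference step of B3 for the zero-background box instance, NOT summit progress.
Unit `lit-balaban-p03-g4` (Phase-2 proof seat p03, gen 4); HOME `run/shared/lean/pub/lit-balaban/` (row B3.Eq2.12, FILED.md, STATUS.md).
-/

namespace Literature.MathematicalPhysics.QuantumFieldTheory.Balaban1983to89.B3Ineq212ZeroBox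

open Finset Matrix
open Literature.MathematicalPhysics.QuantumFieldTheory.Balaban1983to89.B4ContourShift
open Literature.MathematicalPhysics.QuantumFieldTheory.Balaban1983to89.B4Reflection242
open Literature.MathematicalPhysics.QuantumFieldTheory.Balaban1983to89.B4BoxCov237
open Literature.MathematicalPhysics.QuantumFieldTheory.Balaban1983to89.B4Thm110ZeroBox
open Literature.MathematicalPhysics.QuantumFieldTheory.Balaban1983to89.B3Sect2StatementsPart2
open Literature.MathematicalPhysics.QuantumFieldTheory.Balaban1983to89.B3Ineq210ZeroBox

noncomputable section

variable {d : ℕ}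

/-! ## §1 The composite contours `Γ^{(n)}_{x_n,x}` of [Balaban1982Higgs1] (2.1)–(2.2) as sets of fine bonds -/

/-- The corner `x_i = L^i⌊x/L^i⌋` (componentwise, lattice units) of the `L^i`-block `B^i(x_i) ∋ x`: the point of the
`L^iη`-lattice `T^{(i)}` with `x ∈ B^i(x_i)` of paper I (2.2) (*"Let us denote by x_j a point of torus T^{(j)}_{L^jε}, such
that x ∈ B^j(x_j)"*). [cite: Balaban1982Higgs1, (2.2) p.608] -/
def cornerPt (ℓ i : ℕ) (x : Fin (d + 1) → ℤ) : Fin (d + 1) → ℤ :=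
  fun c => ((bj ℓ i : ℕ) : ℤ) * blk (bj ℓ i) x c

/-- The segment of direction `μ` of the staircase contour `Γ_{p,q}` of paper I (2.1) from the corner `p` to the point
`q ≥ p` (componentwise): the fine bonds `⟨w, w + e_μ⟩` with `w_c = p_c` (`c < μ`), `w_c = q_c` (`c > μ`), `p_μ ≤ w_μ < q_μ`
(all positively oriented, as `Γ_{p,q}` runs from `p` up to `q`). [cite: Balaban1982Higgs1, (2.1) p.608] -/
def seg (p q : Fin (d + 1) → ℤ) (μ : Fin (d + 1)) : Finset ((Fin (d + 1) → ℤ) × Fin (d + 1)) :=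
  (Finset.Ico (p μ) (q μ)).image fun t => (fun c => if c < μ then p c else if c = μ then t else q c, μ)

/-- The staircase contour `Γ_{p,q} = ⋃_μ` (segment of direction `μ`) of paper I (2.1), verbatim: *"Γ_{y,x} = ⟨y, (y₁, …,
y_{d−1}, x_d)⟩ ∪ ⟨(y₁, …, y_{d−1}, x_d), (y₁, …, y_{d−2}, x_{d−1}, x_d)⟩ … ∪ ⟨(y₁, x₂, …, x_d), x⟩ … Each such contour is
composed of the bonds of ε-lattice"*, as a set of fine bonds (base point, direction). [cite: Balaban1982Higgs1, (2.1) p.608] -/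
def stair (p q : Fin (d + 1) → ℤ) : Finset ((Fin (d + 1) → ℤ) × Fin (d + 1)) :=
  Finset.univ.biUnion fun μ => seg p q μ

/-- The composite contour `Γ^{(n)}_{x_n,x} = Γ_{x_n,x_{n−1}} ∪ Γ_{x_{n−1},x_{n−2}} ∪ … ∪ Γ_{x_1,x}` of paper I (2.2) (`x_0 = x`,
`x_i` = `cornerPt ℓ i x`), as a set of fine bonds. [cite: Balaban1982Higgs1, (2.2) p.608] -/
def contourN (ℓ n : ℕ) (x : Fin (d + 1) → ℤ) : Finset ((Fin (d + 1) → ℤ) × Fin (d + 1)) :=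
  (Finset.range n).biUnion fun i => stair (cornerPt ℓ (i + 1) x) (cornerPt ℓ i x)

section Contours

variable {ℓ : ℕ}

/-- kernel: `x_0 = x`. [folklore] -/
private theorem cornerPt_zero (x : Fin (d + 1) → ℤ) : cornerPt ℓ 0 x = x := by
  funext c
  simp [cornerPt, blk, bj]

/-- kernel: `x_i ≤ x` componentwise and `x − x_i < L^i` (the block `B^i(x_i)` contains `x`). [folklore] -/
private theorem cornerPt_le_and_lt (i : ℕ) (x : Fin (d + 1) → ℤ) (c : Fin (d + 1)) :
    cornerPt ℓ i x c ≤ x c ∧ x c - cornerPt ℓ i x c < ((bj ℓ i : ℕ) : ℤ) := by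
  have hb : (0 : ℤ) < ((bj ℓ i : ℕ) : ℤ) := by exact_mod_cast bj_pos ℓ i
  have h1 := Int.emod_add_mul_ediv (x c) ((bj ℓ i : ℕ) : ℤ)
  have h2 := Int.emod_nonneg (x c) hb.ne'
  have h3 := Int.emod_lt_of_pos (x c) hb
  simp only [cornerPt, blk]
  constructor <;> omega

/-- kernel: `x ≥ 0 ⇒ x_i ≥ 0` componentwise. [folklore] -/
private theorem cornerPt_nonneg (i : ℕ) {x : Fin (d + 1) → ℤ} {c : Fin (d + 1)} (hx : 0 ≤ x c) :
    0 ≤ cornerPt ℓ i x c := by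
  have hb : (0 : ℤ) < ((bj ℓ i : ℕ) : ℤ) := by exact_mod_cast bj_pos ℓ i
  simp only [cornerPt, blk]
  exact mul_nonneg hb.le (Int.ediv_nonneg hx hb.le)

/-- kernel: the corners descend with the level: `x_{i+1} ≤ x_i` componentwise (an `L^{i+1}`-block is a union of `L^i`-blocks).
[folklore] -/
private theorem cornerPt_succ_le (i : ℕ) (x : Fin (d + 1) → ℤ) (c : Fin (d + 1)) :
    cornerPt ℓ (i + 1) x c ≤ cornerPt ℓ i x c := by
  have hb : (0 : ℤ) < ((bj ℓ i : ℕ) : ℤ) := by exact_mod_cast bj_pos ℓ i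
  have hB := (cornerPt_le_and_lt (ℓ := ℓ) (i + 1) x c).1
  simp only [cornerPt, blk] at hB ⊢
  have hbj : ((bj ℓ (i + 1) : ℕ) : ℤ) = ((ℓ : ℤ) + 1) * ((bj ℓ i : ℕ) : ℤ) := by
    simp [bj, pow_succ, mul_comm]
  rw [hbj] at hB ⊢
  set q := x c / (((ℓ : ℤ) + 1) * ((bj ℓ i : ℕ) : ℤ)) with hq
  have h1 : ((ℓ : ℤ) + 1) * q * ((bj ℓ i : ℕ) : ℤ) ≤ x c := by
    calc ((ℓ : ℤ) + 1) * q * ((bj ℓ i : ℕ) : ℤ) = ((ℓ : ℤ) + 1) * ((bj ℓ i : ℕ) : ℤ) * q := by ring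
      _ ≤ x c := hB
  have h2 : ((ℓ : ℤ) + 1) * q ≤ x c / ((bj ℓ i : ℕ) : ℤ) := Int.le_ediv_of_mul_le hb h1
  calc ((ℓ : ℤ) + 1) * ((bj ℓ i : ℕ) : ℤ) * q = ((bj ℓ i : ℕ) : ℤ) * (((ℓ : ℤ) + 1) * q) := by ring
    _ ≤ ((bj ℓ i : ℕ) : ℤ) * (x c / ((bj ℓ i : ℕ) : ℤ)) := mul_le_mul_of_nonneg_left h2 hb.le

/-- kernel: `i ≤ n ⇒ x_n ≤ x_i` componentwise. [folklore] -/
private theorem cornerPt_anti {i n : ℕ} (h : i ≤ n) (x : Fin (d + 1) → ℤ) (c : Fin (d + 1)) :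
    cornerPt ℓ n x c ≤ cornerPt ℓ i x c := by
  induction n, h using Nat.le_induction with
  | base => exact le_rfl
  | succ n _ ih => exact (cornerPt_succ_le n x c).trans ih

/-- kernel: membership in a segment. [folklore] -/
private theorem mem_seg {p q : Fin (d + 1) → ℤ} {μ : Fin (d + 1)} {b : (Fin (d + 1) → ℤ) × Fin (d + 1)} :
    b ∈ seg p q μ ↔ ∃ t, p μ ≤ t ∧ t < q μ ∧
      b = (fun c => if c < μ then p c else if c = μ then t else q c, μ) := by
  simp only [seg, Finset.mem_image, Finset.mem_Ico]
  constructor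
  · rintro ⟨t, ⟨h1, h2⟩, h3⟩
    exact ⟨t, h1, h2, h3.symm⟩
  · rintro ⟨t, h1, h2, h3⟩
    exact ⟨t, ⟨h1, h2⟩, h3.symm⟩

/-- kernel: the points of `Γ_{p,q}` lie between `p` and `q` (given `p ≤ q` componentwise). [folklore] -/
private theorem stair_bounds {p q : Fin (d + 1) → ℤ} (hpq : ∀ c, p c ≤ q c) {b : (Fin (d + 1) → ℤ) × Fin (d + 1)}
    (hb : b ∈ stair p q) (c : Fin (d + 1)) : p c ≤ b.1 c ∧ b.1 c ≤ q c := by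
  simp only [stair, Finset.mem_biUnion, Finset.mem_univ, true_and] at hb
  obtain ⟨μ, hμ⟩ := hb
  obtain ⟨t, h1, h2, rfl⟩ := mem_seg.1 hμ
  dsimp only
  by_cases hc : c < μ
  · rw [if_pos hc]; exact ⟨le_rfl, hpq c⟩
  · rw [if_neg hc]
    by_cases hc' : c = μ
    · subst hc'; rw [if_pos rfl]; exact ⟨h1, h2.le⟩
    · rw [if_neg hc']; exact ⟨hpq c, le_rfl⟩

/-- kernel: the points of `Γ^{(n)}_{x_n,x}` lie between `x_n` and `x`. [folklore] -/
private theorem contourN_bounds {n : ℕ} {x : Fin (d + 1) → ℤ} {b : (Fin (d + 1) → ℤ) × Fin (d + 1)}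
    (hb : b ∈ contourN ℓ n x) (c : Fin (d + 1)) : cornerPt ℓ n x c ≤ b.1 c ∧ b.1 c ≤ x c := by
  simp only [contourN, Finset.mem_biUnion, Finset.mem_range] at hb
  obtain ⟨i, hi, hbi⟩ := hb
  have hst := stair_bounds (fun c => cornerPt_succ_le (ℓ := ℓ) i x c) hbi c
  exact ⟨(cornerPt_anti (by omega : i + 1 ≤ n) x c).trans hst.1,
    hst.2.trans (cornerPt_le_and_lt (ℓ := ℓ) i x c).1⟩

/-- The base points of `Γ^{(n)}_{x_n,x}` are sites of the box when `x` is (the contour lies in `B^n(x_n) ∋ x`, a block of the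
box). [cite: Balaban1982Higgs1, (2.2) p.608] -/
theorem contourN_mem_boxDom {N : Fin (d + 1) → ℕ} {n : ℕ} {x : Fin (d + 1) → ℤ} (hx : x ∈ boxDom N)
    {b : (Fin (d + 1) → ℤ) × Fin (d + 1)} (hb : b ∈ contourN ℓ n x) : b.1 ∈ boxDom N := by
  rw [mem_boxDom] at hx ⊢
  intro c
  have h := contourN_bounds hb c
  exact ⟨(cornerPt_nonneg n (hx c).1).trans h.1, lt_of_le_of_lt h.2 (hx c).2⟩

/-- The base points of `Γ^{(n)}_{x_n,x}` are within `L^n` of `x` (they lie in `B^n(x_n) ∋ x`). [cite: Balaban1982Higgs1, (2.2) p.608] -/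
theorem supNorm_sub_contourN_le {n : ℕ} {x : Fin (d + 1) → ℤ} {b : (Fin (d + 1) → ℤ) × Fin (d + 1)}
    (hb : b ∈ contourN ℓ n x) : supNorm (x - b.1) ≤ ((bj ℓ n : ℕ) : ℝ) := by
  refine supNorm_le_of_forall fun c => ?_
  have h := contourN_bounds hb c
  have h2 := (cornerPt_le_and_lt (ℓ := ℓ) n x c).2
  have : |(x - b.1) c| ≤ ((bj ℓ n : ℕ) : ℤ) := by
    rw [Pi.sub_apply, abs_le]
    constructor <;> omega
  exact_mod_cast this

/-- kernel: a segment has at most `q_μ − p_μ` bonds. [folklore] -/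
private theorem card_seg_le {p q : Fin (d + 1) → ℤ} (μ : Fin (d + 1)) (h : p μ ≤ q μ) :
    ((seg p q μ).card : ℤ) ≤ q μ - p μ := by
  have h1 : (seg p q μ).card ≤ (Finset.Ico (p μ) (q μ)).card := Finset.card_image_le
  rw [Int.card_Ico] at h1
  have h2 : (((q μ - p μ).toNat : ℕ) : ℤ) = q μ - p μ := Int.toNat_of_nonneg (by omega)
  calc ((seg p q μ).card : ℤ) ≤ (((q μ - p μ).toNat : ℕ) : ℤ) := by exact_mod_cast h1
    _ = q μ - p μ := h2

/-- kernel: `#Γ_{p,q} ≤ Σ_μ (q_μ − p_μ)` for `p ≤ q`. [folklore] -/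
private theorem card_stair_le {p q : Fin (d + 1) → ℤ} (hpq : ∀ c, p c ≤ q c) :
    ((stair p q).card : ℤ) ≤ ∑ μ : Fin (d + 1), (q μ - p μ) := by
  have h1 : (stair p q).card ≤ ∑ μ : Fin (d + 1), (seg p q μ).card := Finset.card_biUnion_le
  calc ((stair p q).card : ℤ) ≤ ((∑ μ : Fin (d + 1), (seg p q μ).card : ℕ) : ℤ) := by exact_mod_cast h1
    _ = ∑ μ : Fin (d + 1), ((seg p q μ).card : ℤ) := by push_cast; rfl
    _ ≤ ∑ μ : Fin (d + 1), (q μ - p μ) := Finset.sum_le_sum fun μ _ => card_seg_le μ (hpq μ)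

/-- **The number of fine bonds of `Γ^{(n)}_{x_n,x}`** is at most `Σ_c (x_c − (x_n)_c)` (the staircases telescope:
`Σ_{i<n}Σ_c((x_i)_c − (x_{i+1})_c) = Σ_c(x_c − (x_n)_c)`), hence `≤ (d+1)(L^n − 1)` — the growth *"the number of these bonds in
Γ_{y,x} grows with k"* of paper I p. 608 made quantitative. [cite: Balaban1982Higgs1, (2.1)–(2.2) p.608] -/
theorem card_contourN_le (n : ℕ) (x : Fin (d + 1) → ℤ) :
    ((contourN ℓ n x).card : ℤ) ≤ ∑ c : Fin (d + 1), (x c - cornerPt ℓ n x c) := by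
  have h1 : (contourN ℓ n x).card
      ≤ ∑ i ∈ Finset.range n, (stair (cornerPt ℓ (i + 1) x) (cornerPt ℓ i x)).card := Finset.card_biUnion_le
  calc ((contourN ℓ n x).card : ℤ)
      ≤ ((∑ i ∈ Finset.range n, (stair (cornerPt ℓ (i + 1) x) (cornerPt ℓ i x)).card : ℕ) : ℤ) := by
        exact_mod_cast h1
    _ = ∑ i ∈ Finset.range n, ((stair (cornerPt ℓ (i + 1) x) (cornerPt ℓ i x)).card : ℤ) := by push_cast; rfl
    _ ≤ ∑ i ∈ Finset.range n, ∑ c : Fin (d + 1), (cornerPt ℓ i x c - cornerPt ℓ (i + 1) x c) :=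
        Finset.sum_le_sum fun i _ => card_stair_le fun c => cornerPt_succ_le i x c
    _ = ∑ c : Fin (d + 1), ∑ i ∈ Finset.range n, (cornerPt ℓ i x c - cornerPt ℓ (i + 1) x c) := Finset.sum_comm
    _ = ∑ c : Fin (d + 1), (x c - cornerPt ℓ n x c) := by
        refine Finset.sum_congr rfl fun c _ => ?_
        rw [Finset.sum_range_sub' (fun i => cornerPt ℓ i x c), cornerPt_zero]

/-- `#Γ^{(n)}_{x_n,x} ≤ (d+1)·L^n` (real form of `card_contourN_le`). [cite: Balaban1982Higgs1, (2.1)–(2.2) p.608] -/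
theorem card_contourN_le_real (n : ℕ) (x : Fin (d + 1) → ℤ) :
    ((contourN ℓ n x).card : ℝ) ≤ ((d : ℝ) + 1) * ((bj ℓ n : ℕ) : ℝ) := by
  have h1 := card_contourN_le (ℓ := ℓ) n x
  have h2 : ∑ c : Fin (d + 1), (x c - cornerPt ℓ n x c) ≤ ∑ _c : Fin (d + 1), ((bj ℓ n : ℕ) : ℤ) :=
    Finset.sum_le_sum fun c _ => (cornerPt_le_and_lt (ℓ := ℓ) n x c).2.le
  rw [Finset.sum_const, Finset.card_univ, Fintype.card_fin, nsmul_eq_mul] at h2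
  have h3 : ((contourN ℓ n x).card : ℤ) ≤ ((d + 1 : ℕ) : ℤ) * ((bj ℓ n : ℕ) : ℤ) := h1.trans h2
  have h4 : (((contourN ℓ n x).card : ℤ) : ℝ) ≤ ((((d + 1 : ℕ) : ℤ) * ((bj ℓ n : ℕ) : ℤ) : ℤ) : ℝ) := by
    exact_mod_cast h3
  push_cast at h4
  rw [bj_cast]
  exact h4

end Contours

/-! ## §2 The averaged vector-leg kernel `G^η_{(j)}(Γ^{(j+1)}_{x_{j+1},x}, b)` and the block distance `dist(B^j(x), b)` at `A = 0` -/

section Kernels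

variable {ℓ k : ℕ} {M : Fin (d + 1) → ℕ} {a m2 : ℝ}

/-- The scale piece `G^η_{(j)}(z, x′)` (counting normalisation, `B3Ineq210ZeroBox.piece`) read at a raw lattice point `z`
in the first variable (`0` off the box — the contour bonds all lie in the box, `contourN_mem_boxDom`).
[cite: Balaban1983Higgs3, (2.6) p.424] -/
def pieceAt (ℓ k : ℕ) (M : Fin (d + 1) → ℕ) (j : ℕ) (a m2 : ℝ) (z : Fin (d + 1) → ℤ)
    (x' : ↥(boxDom (Nf ℓ k M))) : ℝ :=
  if h : z ∈ boxDom (Nf ℓ k M) then piece ℓ k M j a m2 ⟨z, h⟩ x' else 0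

/-- The scale piece of the VECTOR-field propagator at `A = 0` between a fine bond `b′ = ⟨z, z+ηe_ν⟩` and a bond
`b = ⟨x_b, x_b+ηe_μ⟩`: `δ_{νμ}·G^η_{(j)}(z, x_b)` — paper I p. 608: *"The renormalization transformations for vector fields will be
obtained by taking N = d and an external vector field A = 0"* (the `d` components `A_μ(x) = A_{⟨x,x+ηe_μ⟩}` are independent copies
of the scalar field, so (2.6) holds componentwise: B3 p. 424 *"and the similar equality for the vector field propagator"*).
[cite: Balaban1983Higgs3, (2.6) p.424] -/
def vecPiece (ℓ k : ℕ) (M : Fin (d + 1) → ℕ) (j : ℕ) (a m2 : ℝ) (b' : (Fin (d + 1) → ℤ) × Fin (d + 1))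
    (b : ↥(boxDom (Nf ℓ k M)) × Fin (d + 1)) : ℝ :=
  if b'.2 = b.2 then pieceAt ℓ k M j a m2 b'.1 b.1 else 0

/-- `G^η_{(j)}(Γ^{(j+1)}_{x_{j+1},x}, b)` stripped of its normalisation factors: `Σ_{b′ ⊂ Γ^{(j+1)}_{x_{j+1},x}} δ_{ν(b′)μ(b)}G_{(j)}(z(b′), x_b)`
— the vector leg `A′^{(j),η}(Γ^{(j+1)}_{x_{j+1},x}) = Σ_{b′⊂Γ} ηA′_{b′}` of (1.3) contracted with the leg `A′_b` (B3 p. 426: *"If a leg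
A′ of the line is in one of the vertices (1.14) and (1.15), then we have the expression A′^{(j),η}(Γ^{j+1}_{x_{j+1},x}) on the basis of
(1.3)"*; all bonds of `Γ` positively oriented). [cite: Balaban1983Higgs3, (2.12) p.426] -/
def gsum (ℓ k : ℕ) (M : Fin (d + 1) → ℕ) (j : ℕ) (a m2 : ℝ) (x : ↥(boxDom (Nf ℓ k M)))
    (b : ↥(boxDom (Nf ℓ k M)) × Fin (d + 1)) : ℝ :=
  ∑ b' ∈ contourN ℓ (j + 1) x.1, vecPiece ℓ k M j a m2 b' b

/-- The block `B^j(x) ∩ □` of the fine site `x` as a set of lattice points (`b_j = L^j` fine points per direction).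
[cite: Balaban1983Higgs3, (2.12) p.426] -/
def blockSites (ℓ k : ℕ) (M : Fin (d + 1) → ℕ) (j : ℕ) (x : ↥(boxDom (Nf ℓ k M))) : Finset (Fin (d + 1) → ℤ) :=
  (boxDom (Nf ℓ k M)).filter fun z => blk (bj ℓ j) z = blk (bj ℓ j) x.1

/-- `x ∈ B^j(x)`. [cite: Balaban1983Higgs3, (2.12) p.426] -/
theorem self_mem_blockSites (j : ℕ) (x : ↥(boxDom (Nf ℓ k M))) : x.1 ∈ blockSites ℓ k M j x := by
  simp [blockSites, x.2]

/-- `dist(B^j(x), b)` in lattice units: the sup-distance between the point set `B^j(x) ∩ □` and the two end-points `x_b`,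
`x_b + e_μ` of the bond `b`. [cite: Balaban1983Higgs3, (2.12) p.426] -/
def distBlockLat (ℓ k : ℕ) (M : Fin (d + 1) → ℕ) (j : ℕ) (x : ↥(boxDom (Nf ℓ k M)))
    (b : ↥(boxDom (Nf ℓ k M)) × Fin (d + 1)) : ℝ :=
  (blockSites ℓ k M j x).inf' ⟨x.1, self_mem_blockSites j x⟩
    fun z => min (supNorm (z - b.1.1)) (supNorm (z - (b.1.1 + Pi.single b.2 1)))

/-- `dist(B^j(x), b) ≤ |x − x_b|_∞`. [cite: Balaban1983Higgs3, (2.12) p.426] -/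
theorem distBlockLat_le (j : ℕ) (x : ↥(boxDom (Nf ℓ k M))) (b : ↥(boxDom (Nf ℓ k M)) × Fin (d + 1)) :
    distBlockLat ℓ k M j x b ≤ supNorm (x.1 - b.1.1) := by
  unfold distBlockLat
  exact (Finset.inf'_le _ (self_mem_blockSites j x)).trans (min_le_left _ _)

/-- no pieces beyond `j = k − 1`: the averaged kernel vanishes there too. [cite: Balaban1983Higgs3, (2.12) p.426] -/
theorem gsum_of_le {j : ℕ} (hj1 : 1 ≤ j) (hkj : k ≤ j) (x : ↥(boxDom (Nf ℓ k M)))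
    (b : ↥(boxDom (Nf ℓ k M)) × Fin (d + 1)) : gsum ℓ k M j a m2 x b = 0 := by
  unfold gsum
  refine Finset.sum_eq_zero fun b' _ => ?_
  unfold vecPiece pieceAt
  split_ifs
  · rw [piece_of_le hj1 hkj, Matrix.zero_apply]
  · rfl
  · rfl

end Kernels

/-! ## §3 (2.12) in the counting normalisation: the sum along the contour costs `#Γ ≤ (d+1)L^{j+1}` pointwise bounds (2.10) -/

/-- kernel: `b_{j+1} = L·b_j`. [folklore] -/
private theorem bj_succ (ℓ j : ℕ) : ((bj ℓ (j + 1) : ℕ) : ℝ) = ((ℓ : ℝ) + 1) * ((bj ℓ j : ℕ) : ℝ) := by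
  rw [bj_cast, bj_cast, pow_succ, mul_comm]

/-- **B3 (2.12) p. 426 [PDF 16] for the model instance `A = B̃ = 0`, `Ω = □`, counting normalisation**: there are `δ₁ > 0`,
`C > 0` (depending on `d`, `L`, the window only) with `|Σ_{b′⊂Γ^{(j+1)}_{x_{j+1},x}} δ_{ν(b′)μ(b)}G_{(j)}(z(b′),x_b)| ≤
C·L^{−jd}·(L^jη)²·e^{−δ₁|x−x_b|_∞/L^j}` for every `k ≥ 1`, `j < k`, window point, box, fine site `x` and bond `b = (x_b, μ)` — one
factor `L^j = b_j` MORE than the pointwise bound (2.10) (`B3Ineq210ZeroBox.abs_piece_le`), from the `≤ (d+1)(L^{j+1} − 1)` bonds of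
the contour (`card_contourN_le`), all within `L^{j+1}` of `x` (`supNorm_sub_contourN_le`); after the normalisation `η^{−(d+1)}·η`
this is the printed `O(1)(L^jη)^{−d+3}` (*"For each such expression we have an additional factor L^jη on the right side"*).
[cite: Balaban1983Higgs3, (2.12) p.426] -/
theorem abs_gsum_le (d ℓ : ℕ) (hℓ : 1 ≤ ℓ) (amin aplus m2plus : ℝ) (ha : 0 < amin) :
    ∃ δ₁ C : ℝ, 0 < δ₁ ∧ 0 < C ∧ ∀ (k : ℕ), 1 ≤ k → ∀ (j : ℕ), j < k → ∀ (a m2 : ℝ), amin ≤ a → a ≤ aplus →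
      0 ≤ m2 → m2 ≤ m2plus → ∀ (M : Fin (d + 1) → ℕ), (∀ i, 1 ≤ M i) →
        ∀ (x : ↥(boxDom (Nf ℓ k M))) (b : ↥(boxDom (Nf ℓ k M)) × Fin (d + 1)),
          |gsum ℓ k M j a m2 x b| ≤ C * ((((bj ℓ j : ℕ) : ℝ) ^ d)⁻¹ * (sc ℓ k j ^ 2)⁻¹)
            * Real.exp (-(δ₁ * supNorm (x.1 - b.1.1) / ((bj ℓ j : ℕ) : ℝ))) := by
  obtain ⟨δv, Cv, hδv, hCv, hV⟩ := abs_piece_le d ℓ hℓ amin aplus m2plus ha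
  have hL : (0 : ℝ) < (ℓ : ℝ) + 1 := by positivity
  refine ⟨δv, ((d : ℝ) + 1) * ((ℓ : ℝ) + 1) * Cv * Real.exp (δv * ((ℓ : ℝ) + 1)), hδv, by positivity, ?_⟩
  intro k hk j hjk a m2 h1 h2 h3 h4 M hM x b
  have hb1 : 1 ≤ bj ℓ j := bj_pos ℓ j
  have hbR : (0 : ℝ) < ((bj ℓ j : ℕ) : ℝ) := by positivity
  have hbD : (0 : ℝ) < ((bj ℓ j : ℕ) : ℝ) ^ (d + 1) := by positivity
  have hsi : 0 < (sc ℓ k j ^ 2)⁻¹ := inv_pos.2 (pow_pos (sc_pos ℓ k j) 2)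
  set n : ℝ := supNorm (x.1 - b.1.1) with hn
  have hn0 : 0 ≤ n := supNorm_nonneg _
  -- the per-bond bound
  set Bnd : ℝ := Cv * ((((bj ℓ j : ℕ) : ℝ) ^ (d + 1))⁻¹ * (sc ℓ k j ^ 2)⁻¹)
      * (Real.exp (δv * ((ℓ : ℝ) + 1)) * Real.exp (-(δv * n / ((bj ℓ j : ℕ) : ℝ)))) with hBnd
  have hBnd0 : 0 ≤ Bnd := by positivity
  have hterm : ∀ b' ∈ contourN ℓ (j + 1) x.1, |vecPiece ℓ k M j a m2 b' b| ≤ Bnd := by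
    intro b' hb'
    unfold vecPiece pieceAt
    have hz : b'.1 ∈ boxDom (Nf ℓ k M) := contourN_mem_boxDom x.2 hb'
    split_ifs with hνμ
    · have hv := hV k hk j hjk a m2 h1 h2 h3 h4 M hM ⟨b'.1, hz⟩ b.1
      have hnear : supNorm (x.1 - b'.1) ≤ ((bj ℓ (j + 1) : ℕ) : ℝ) := supNorm_sub_contourN_le hb'
      have htri : n ≤ supNorm (x.1 - b'.1) + supNorm (b'.1 - b.1.1) := supNorm_sub_le_sub_add_sub x.1 b'.1 b.1.1
      have hexp : Real.exp (-(δv * supNorm (b'.1 - b.1.1) / ((bj ℓ j : ℕ) : ℝ)))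
          ≤ Real.exp (δv * ((ℓ : ℝ) + 1)) * Real.exp (-(δv * n / ((bj ℓ j : ℕ) : ℝ))) := by
        rw [← Real.exp_add]
        apply Real.exp_le_exp.2
        rw [bj_succ] at hnear
        have e1 : δv * n / ((bj ℓ j : ℕ) : ℝ) ≤ δv * (((ℓ : ℝ) + 1) * ((bj ℓ j : ℕ) : ℝ) + supNorm (b'.1 - b.1.1))
            / ((bj ℓ j : ℕ) : ℝ) :=
          div_le_div_of_nonneg_right (mul_le_mul_of_nonneg_left (by linarith) hδv.le) hbR.le
        have e2 : δv * (((ℓ : ℝ) + 1) * ((bj ℓ j : ℕ) : ℝ) + supNorm (b'.1 - b.1.1)) / ((bj ℓ j : ℕ) : ℝ)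
            = δv * ((ℓ : ℝ) + 1) + δv * supNorm (b'.1 - b.1.1) / ((bj ℓ j : ℕ) : ℝ) := by
          field_simp
        linarith
      calc |piece ℓ k M j a m2 ⟨b'.1, hz⟩ b.1|
          ≤ Cv * ((((bj ℓ j : ℕ) : ℝ) ^ (d + 1))⁻¹ * (sc ℓ k j ^ 2)⁻¹)
              * Real.exp (-(δv * supNorm (b'.1 - b.1.1) / ((bj ℓ j : ℕ) : ℝ))) := hv
        _ ≤ Bnd := mul_le_mul_of_nonneg_left hexp (by positivity)
    · rw [abs_zero]; exact hBnd0
  -- summing over the contour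
  have hcard := card_contourN_le_real (ℓ := ℓ) (j + 1) x.1
  have hsum : |gsum ℓ k M j a m2 x b| ≤ ((d : ℝ) + 1) * ((bj ℓ (j + 1) : ℕ) : ℝ) * Bnd := by
    unfold gsum
    calc |∑ b' ∈ contourN ℓ (j + 1) x.1, vecPiece ℓ k M j a m2 b' b|
        ≤ ∑ b' ∈ contourN ℓ (j + 1) x.1, |vecPiece ℓ k M j a m2 b' b| := Finset.abs_sum_le_sum_abs _ _
      _ ≤ (contourN ℓ (j + 1) x.1).card • Bnd := Finset.sum_le_card_nsmul _ _ _ hterm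
      _ = ((contourN ℓ (j + 1) x.1).card : ℝ) * Bnd := by rw [nsmul_eq_mul]
      _ ≤ ((d : ℝ) + 1) * ((bj ℓ (j + 1) : ℕ) : ℝ) * Bnd := mul_le_mul_of_nonneg_right hcard hBnd0
  refine hsum.trans (le_of_eq ?_)
  rw [hBnd, bj_succ, pow_succ]
  field_simp

/-! ## §4 The extended carrier (bonds and the (2.12) fields modelled) and `Ineq212`, `Ineq210` DISCHARGED -/

/-- kernel: `(s⁻¹)^{3−n} = s^n·s^{−3}` (real exponent). [folklore] -/
private theorem inv_rpow_three_sub {s : ℝ} (hs : 0 < s) (n : ℕ) :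
    (s⁻¹) ^ ((3 : ℝ) - (n : ℝ)) = s ^ n * (s ^ 3)⁻¹ := by
  rw [Real.inv_rpow hs.le, Real.rpow_sub hs, Real.rpow_natCast, inv_div, div_eq_mul_inv]
  norm_num

/-- kernel: `η^{−n}·L^{−jn} = s_j^{n}` (`L^k = s_jb_j`). [folklore] -/
private theorem Lk_pow_mul_inv_bj_pow' {ℓ k j : ℕ} (hj : j ≤ k) (n : ℕ) :
    ((((ℓ + 1) ^ k : ℕ) : ℝ)) ^ n * ((((bj ℓ j : ℕ) : ℝ)) ^ n)⁻¹ = sc ℓ k j ^ n := by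
  have h := sc_mul_bj (ℓ := ℓ) hj
  rw [bj_cast] at h
  have hL : (0 : ℝ) < ((ℓ : ℝ) + 1) ^ j := by positivity
  push_cast [bj_cast]
  rw [← h, mul_pow]
  field_simp

/-- **The extended concrete carrier for the MODEL INSTANCE `A = B̃ = 0`, `Ω = □`**: as `B3Ineq210ZeroBox.zeroBoxKernels` (same
`Site`, `dist`, `L`, `η`, `d`, (2.10) kernels `absG`/`absDG`), and IN ADDITION the (2.12) fields: `Bond` = (base point `x_b ∈ □`,
direction `μ`) [pairs whose upper end-point `x_b + e_μ` leaves `□` are not bonds of the Neumann box; they are harmless extra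
elements, the bound is proved for them too], `distBlock j x b = η·dist_∞(B^j(x) ∩ □, {x_b, x_b+e_μ})` (`distBlockLat`), and
`absGavg j x b = |G^η_{(j)}(Γ^{(j+1)}_{x_{j+1},x}, b)| = η^{−(d+1)}·|Σ_{b′⊂Γ} η·δ_{ν(b′)μ}G_{(j)}(z(b′), x_b)|` (`gsum`; print's `η^d`-normalised
vector kernel, `N = d + 1` copies of the scalar pieces at `A = 0`, summed with the contour weight `η` of (1.3)/(I.2.3)).  DECLARED
DIVERGENCE (F7): the (2.5)/(2.11) fields (`LocFn`, `dist2`, `distSupp`, `distΩ₂`, `eRun`, `pRun`, `holderDiff`, `normDeltaG`,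
`norm116`) stay NOT MODELLED (`Unit`/`0`); nothing is claimed about `Ineq25`/`Ineq211` of this instance.
[cite: Balaban1983Higgs3, (2.6) p.424, (2.10)–(2.12) p.426] -/
def zeroBoxKernelsV (ℓ k : ℕ) (hℓ : 1 ≤ ℓ) (M : Fin (d + 1) → ℕ) (a m2 : ℝ) : ScaledKernels where
  Site := ↥(boxDom (Nf ℓ k M))
  Bond := ↥(boxDom (Nf ℓ k M)) × Fin (d + 1)
  Dir := Fin (d + 1)
  LocFn := Unit
  dist x x' := supNorm (x.1 - x'.1) / (((ℓ + 1) ^ k : ℕ) : ℝ)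
  dist2 _ _ _ := 0
  distBlock j x b := distBlockLat ℓ k M j x b / (((ℓ + 1) ^ k : ℕ) : ℝ)
  distSupp _ _ := 0
  distΩ₂ := 0
  L := (ℓ : ℝ) + 1
  η := ((((ℓ + 1) ^ k : ℕ) : ℝ))⁻¹
  d := d + 1
  eRun := 0
  pRun := 0
  one_lt_L := one_lt_L_real hℓ
  η_pos := inv_pos.2 (by positivity)
  absG j x x' := ((((ℓ + 1) ^ k : ℕ) : ℝ)) ^ (d + 1) * |piece ℓ k M j a m2 x x'|
  absDG j μ x x' :=
    if h : x.1 + Pi.single μ 1 ∈ boxDom (Nf ℓ k M) then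
      ((((ℓ + 1) ^ k : ℕ) : ℝ)) ^ (d + 1)
        * (((((ℓ + 1) ^ k : ℕ) : ℝ)) * |piece ℓ k M j a m2 ⟨x.1 + Pi.single μ 1, h⟩ x' - piece ℓ k M j a m2 x x'|)
    else 0
  holderDiff _ _ _ _ _ := 0
  absGavg j x b := ((((ℓ + 1) ^ k : ℕ) : ℝ)) ^ (d + 1) * (((((ℓ + 1) ^ k : ℕ) : ℝ))⁻¹ * |gsum ℓ k M j a m2 x b|)
  normDeltaG _ _ _ := 0
  norm116 _ _ _ _ _ := 0

section CarrierV

variable {ℓ k : ℕ} {hℓ : 1 ≤ ℓ} {M : Fin (d + 1) → ℕ} {a m2 : ℝ}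

/-- the length scale `L^jη = s_j^{-1}` of the extended carrier (`j ≤ k`). [cite: Balaban1983Higgs3, (2.12) p.426] -/
theorem scaleV_eq {j : ℕ} (hj : j ≤ k) : (zeroBoxKernelsV ℓ k hℓ M a m2).scale j = (sc ℓ k j)⁻¹ :=
  scale_eq (hℓ := hℓ) (M := M) (a := a) (m2 := m2) hj

/-- the length scales of the extended carrier are positive. [cite: Balaban1983Higgs3, (2.12) p.426] -/
theorem scaleV_pos (j : ℕ) : 0 < (zeroBoxKernelsV ℓ k hℓ M a m2).scale j :=
  scale_pos (hℓ := hℓ) (M := M) (a := a) (m2 := m2) j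

end CarrierV

/-- **(2.10) for the extended carrier**: `Ineq210 δ₁ C` of `zeroBoxKernelsV` IS `Ineq210 δ₁ C` of `B3Ineq210ZeroBox.zeroBoxKernels`
(the (2.10) fields coincide), discharged by `B3Ineq210ZeroBox.ineq210_zeroBox`. [cite: Balaban1983Higgs3, (2.10) p.426] -/
theorem ineq210_zeroBoxV (d ℓ : ℕ) (hℓ : 1 ≤ ℓ) (amin aplus m2plus : ℝ) (ha : 0 < amin) :
    ∃ δ₁ C : ℝ, 0 < δ₁ ∧ 0 < C ∧ ∀ (k : ℕ), 1 ≤ k → ∀ (a m2 : ℝ), amin ≤ a → a ≤ aplus → 0 ≤ m2 →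
      m2 ≤ m2plus → ∀ (M : Fin (d + 1) → ℕ), (∀ i, 1 ≤ M i) →
        (zeroBoxKernelsV ℓ k hℓ M a m2).Ineq210 δ₁ C := by
  obtain ⟨δ₁, C, hδ, hC, h⟩ := ineq210_zeroBox d ℓ hℓ amin aplus m2plus ha
  exact ⟨δ₁, C, hδ, hC, fun k hk a m2 h1 h2 h3 h4 M hM => h k hk a m2 h1 h2 h3 h4 M hM⟩

/-- **B3 (2.12) p. 426 [PDF 16] — `ScaledKernels.Ineq212 δ₁ C` DISCHARGED for the model instance `A = B̃ = 0`, `Ω = □`.**  Verbatim: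
*"Of course the same inequalities hold for vector field propagators, but we have to estimate some additional expressions also. If
a leg A′ of the line is in one of the vertices (1.14) and (1.15), then we have the expression A′^{(j),η}(Γ^{j+1}_{x_{j+1},x}) on the
basis of (1.3). For each such expression we have an additional factor L^jη on the right side, e.g. we have
|G^η_{(j)}(Γ^{(j+1)}_{x_{j+1},x}, b)| ≤ O(1)(L^jη)^{−d+3}e^{−δ₁(L^jη)^{−1}dist(B^j(x),b)}. (2.12)"*  HERE: there are `δ₁ > 0`, `C > 0` depending
only on `d + 1`, `L = ℓ + 1` and the window such that for EVERY scale `k ≥ 1`, every `(a, m²)` in the window and every box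
`□ = Π_μ[0,M_μ)`, the extended carrier `zeroBoxKernelsV` satisfies `Ineq212 δ₁ C`: `absGavg j x b ≤ C·(L^jη)^{3−(d+1)}·e^{−δ₁(L^jη)^{−1}distBlock j x b}`
with the composite contours `Γ^{(j+1)}_{x_{j+1},x}` of paper I (2.1)–(2.2) as positively oriented fine-bond staircases (`contourN`).
HONEST SCOPE: as `B3Ineq210ZeroBox` — `A = B̃ = 0` (vector field = `N = d + 1` independent copies of the scalar field, paper I p. 608),
`Ω = □` a box of unit blocks, sup norm, existential constants depending on `d`, `L`, the window; `dist(B^j(x), b)` = sup-distance from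
`B^j(x) ∩ □` to the two end-points of `b`; ROUTE = (2.10) pointwise (`abs_piece_le`) × the bond count of the contour.
[cite: Balaban1983Higgs3, (2.12) p.426] -/
theorem ineq212_zeroBoxV (d ℓ : ℕ) (hℓ : 1 ≤ ℓ) (amin aplus m2plus : ℝ) (ha : 0 < amin) :
    ∃ δ₁ C : ℝ, 0 < δ₁ ∧ 0 < C ∧ ∀ (k : ℕ), 1 ≤ k → ∀ (a m2 : ℝ), amin ≤ a → a ≤ aplus → 0 ≤ m2 →
      m2 ≤ m2plus → ∀ (M : Fin (d + 1) → ℕ), (∀ i, 1 ≤ M i) →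
        (zeroBoxKernelsV ℓ k hℓ M a m2).Ineq212 δ₁ C := by
  obtain ⟨δ₁, C, hδ, hC, hG⟩ := abs_gsum_le d ℓ hℓ amin aplus m2plus ha
  refine ⟨δ₁, C, hδ, hC, ?_⟩
  intro k hk a m2 h1 h2 h3 h4 M hM j x b
  change ↥(boxDom (Nf ℓ k M)) at x
  change ↥(boxDom (Nf ℓ k M)) × Fin (d + 1) at b
  have hLk : (0 : ℝ) < (((ℓ + 1) ^ k : ℕ) : ℝ) := by positivity
  have hsp : 0 < (zeroBoxKernelsV ℓ k hℓ M a m2).scale j := scaleV_pos j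
  have hSd : ((zeroBoxKernelsV ℓ k hℓ M a m2).d : ℝ) = ((d + 1 : ℕ) : ℝ) := rfl
  have hRHS : 0 ≤ C * (zeroBoxKernelsV ℓ k hℓ M a m2).scale j ^ (3 - ((zeroBoxKernelsV ℓ k hℓ M a m2).d : ℝ))
      * Real.exp (-(δ₁ * ((zeroBoxKernelsV ℓ k hℓ M a m2).scale j)⁻¹
          * (zeroBoxKernelsV ℓ k hℓ M a m2).distBlock j x b)) :=
    mul_nonneg (mul_nonneg hC.le (Real.rpow_pos_of_pos hsp _).le) (Real.exp_pos _).le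
  show ((((ℓ + 1) ^ k : ℕ) : ℝ)) ^ (d + 1) * (((((ℓ + 1) ^ k : ℕ) : ℝ))⁻¹ * |gsum ℓ k M j a m2 x b|) ≤ _
  rcases Nat.lt_or_ge j k with hjk | hkj
  · have hj : j ≤ k := hjk.le
    have hb : (0 : ℝ) < ((bj ℓ j : ℕ) : ℝ) := by have := bj_pos ℓ j; positivity
    have hs := sc_pos ℓ k j
    have hdist : ((zeroBoxKernelsV ℓ k hℓ M a m2).scale j)⁻¹ * (zeroBoxKernelsV ℓ k hℓ M a m2).distBlock j x b
        = distBlockLat ℓ k M j x b / ((bj ℓ j : ℕ) : ℝ) := by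
      rw [scaleV_eq hj, inv_inv]
      show sc ℓ k j * (distBlockLat ℓ k M j x b / (((ℓ + 1) ^ k : ℕ) : ℝ)) = distBlockLat ℓ k M j x b / ((bj ℓ j : ℕ) : ℝ)
      have h := sc_mul_bj (ℓ := ℓ) hj
      rw [bj_cast] at h
      have hL' : (0 : ℝ) < ((ℓ : ℝ) + 1) ^ j := by positivity
      push_cast [bj_cast]
      rw [← h]
      field_simp
    have hexp : Real.exp (-(δ₁ * supNorm (x.1 - b.1.1) / ((bj ℓ j : ℕ) : ℝ)))
        ≤ Real.exp (-(δ₁ * ((zeroBoxKernelsV ℓ k hℓ M a m2).scale j)⁻¹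
            * (zeroBoxKernelsV ℓ k hℓ M a m2).distBlock j x b)) := by
      rw [mul_assoc, hdist]
      apply Real.exp_le_exp.2
      have hD := distBlockLat_le j x b
      rw [mul_div_assoc]
      have : distBlockLat ℓ k M j x b / ((bj ℓ j : ℕ) : ℝ) ≤ supNorm (x.1 - b.1.1) / ((bj ℓ j : ℕ) : ℝ) :=
        div_le_div_of_nonneg_right hD hb.le
      nlinarith
    have hg := hG k hk j hjk a m2 h1 h2 h3 h4 M hM x b
    have hpow : (zeroBoxKernelsV ℓ k hℓ M a m2).scale j ^ (3 - ((zeroBoxKernelsV ℓ k hℓ M a m2).d : ℝ))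
        = sc ℓ k j ^ (d + 1) * (sc ℓ k j ^ 3)⁻¹ := by
      rw [scaleV_eq hj, hSd, inv_rpow_three_sub hs]
    rw [hpow]
    calc ((((ℓ + 1) ^ k : ℕ) : ℝ)) ^ (d + 1) * (((((ℓ + 1) ^ k : ℕ) : ℝ))⁻¹ * |gsum ℓ k M j a m2 x b|)
        ≤ ((((ℓ + 1) ^ k : ℕ) : ℝ)) ^ (d + 1) * (((((ℓ + 1) ^ k : ℕ) : ℝ))⁻¹
            * (C * ((((bj ℓ j : ℕ) : ℝ) ^ d)⁻¹ * (sc ℓ k j ^ 2)⁻¹)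
              * Real.exp (-(δ₁ * supNorm (x.1 - b.1.1) / ((bj ℓ j : ℕ) : ℝ))))) :=
          mul_le_mul_of_nonneg_left (mul_le_mul_of_nonneg_left hg (inv_pos.2 hLk).le) (by positivity)
      _ = C * (((((ℓ + 1) ^ k : ℕ) : ℝ)) ^ d * ((((bj ℓ j : ℕ) : ℝ)) ^ d)⁻¹) * (sc ℓ k j ^ 2)⁻¹
            * Real.exp (-(δ₁ * supNorm (x.1 - b.1.1) / ((bj ℓ j : ℕ) : ℝ))) := by
          rw [pow_succ]
          field_simp
      _ = C * (sc ℓ k j ^ (d + 1) * (sc ℓ k j ^ 3)⁻¹)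
            * Real.exp (-(δ₁ * supNorm (x.1 - b.1.1) / ((bj ℓ j : ℕ) : ℝ))) := by
          rw [Lk_pow_mul_inv_bj_pow' hj d]
          field_simp
          ring
      _ ≤ C * (sc ℓ k j ^ (d + 1) * (sc ℓ k j ^ 3)⁻¹)
            * Real.exp (-(δ₁ * ((zeroBoxKernelsV ℓ k hℓ M a m2).scale j)⁻¹
                * (zeroBoxKernelsV ℓ k hℓ M a m2).distBlock j x b)) :=
          mul_le_mul_of_nonneg_left hexp (by positivity)
  · have hj1 : 1 ≤ j := le_trans hk hkj
    rw [gsum_of_le hj1 hkj, abs_zero, mul_zero, mul_zero]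
    exact hRHS

/-! ## §5 Non-vacuity: the binders are inhabited (`d + 1 = 3`, `L = 2`, window `[1/2, 2] × [0, 1]`, `k = 1`, unit cube) -/

/-- **Non-vacuity witness**: (2.12) holds, with the constants of `ineq212_zeroBoxV` for `d + 1 = 3`, `L = 2` and the window
`[1/2, 2] × [0, 1]`, for the instance `k = 1`, `□ = [0,1)³`, `a = 1`, `m² = 0`. [cite: Balaban1983Higgs3, (2.12) p.426] -/
theorem ineq212_zeroBoxV_witness :
    ∃ δ₁ C : ℝ, 0 < δ₁ ∧ 0 < C ∧ (zeroBoxKernelsV (d := 2) 1 1 le_rfl (fun _ => 1) 1 0).Ineq212 δ₁ C := by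
  obtain ⟨δ₁, C, hδ, hC, h⟩ := ineq212_zeroBoxV 2 1 le_rfl (1 / 2) 2 1 (by norm_num)
  exact ⟨δ₁, C, hδ, hC, h 1 le_rfl 1 0 (by norm_num) (by norm_num) le_rfl (by norm_num) _ fun _ => le_rfl⟩

end

end Literature.MathematicalPhysics.QuantumFieldTheory.Balaban1983to89.B3Ineq212ZeroBox
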